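import Summits.ValiantsHypothesis.ValiantsHypothesis.Theorems.VPBoundarySquareTowerFamily
import Summits.ValiantsHypothesis.ValiantsHypothesis.Theorems.VPBoundarySquareDegreeFormat
import HarnessLib

/-!
# VPBoundarySquare — `VNP^ℂ` has the same DEGREE FORMAT: the degree shadow is blind to
`\overline{VP}` versus `VNP` (decomp-valiant lens 3, NODE v9, calibration of theorem T4)

T4 (`VPBoundarySquareDegree*`) proved that `\overline{VP}^ℂ` p-families satisfy the p-bounded DEGREE
FORMAT: `ℚ`-linearly independent power products `∏ i, (coeff_{c i} f_n)^{j i}` (`j i < δ i`) obey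
`∏ i, δ i ≤ (2^{B n} · Σ_i (δ i − 1) + 1)^{B n}`. This file proves the SAME conclusion for `VNP^ℂ`
(`isVNPFamily_degreeBound`): a `VNP` family is a Boolean sum `Σ_e g_n(x, e)` of a `VP` family, the
coefficients of `g_n = Φ_N(γ)` are values `H_d(γ)` of rational polynomials of degree `≤ deg G_N`, a
Boolean sum only takes `ℕ`-linear combinations of them (`cdeg_boolSum`), and the plain degree method
(`prod_le_of_linearIndependent_aeval`) applies. Consequences, recorded honestly:

* the degree-type instrument of the lens CANNOT separate `\overline{VP}` from `VNP` — it can never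
  feed the residual crux `EmptyBoundarySeparates` (Q); it calibrates U_CH only;
* `not_isVNPFamily_towerFamily`: the tower family `Σ_{S ⊆ [n]} t^{2^{bin S}} x^S` (transcendental `t`)
  is outside `VNP^ℂ` as well as outside `\overline{VP}^ℂ` (`not_isVPBarFamily_towerFamily`) — the
  kernel form of the caveat in NODE §v9 addendum 2.

0 sorry; no statement of record changes. Sources: Valiant 1979 / Bürgisser 2000 Def. 2.5 (Boolean sum);
Bürgisser–Clausen–Shokrollahi 1997 Thm. (9.3) [corpus chunk p0246].
-/

noncomputable section

set_option linter.dupNamespace false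

open MvPolynomial
open Literature.Computability.AlgebraicComplexity

namespace Summit.ValiantsHypothesis.ValiantsHypothesis.Theorems.VPBoundarySquareVNPDegreeFormat

open Summit.ValiantsHypothesis.ValiantsHypothesis.Theorems.VPBoundarySquareTrdeg
open Summit.ValiantsHypothesis.ValiantsHypothesis.Theorems.VPBoundarySquareDegree
open Summit.ValiantsHypothesis.ValiantsHypothesis.Theorems.VPBoundarySquareDegreeFormat
open Summit.ValiantsHypothesis.ValiantsHypothesis.Theorems.VPBoundarySquareTowerFamily

/-! ### Boolean sums at the generic level -/

/-- Change of scalars commutes with Valiant's Boolean sum. [folklore] -/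
theorem map_boolSum_eq {R S : Type} [CommSemiring R] [CommSemiring S] (φ : R →+* S) {τ : Type}
    {m : ℕ} (g : MvPolynomial (τ ⊕ Fin m) R) :
    MvPolynomial.map φ (boolSum g) = boolSum (MvPolynomial.map φ g) := by
  unfold boolSum
  rw [map_sum]
  refine Finset.sum_congr rfl fun e _ => ?_
  show MvPolynomial.map φ (bind₁ _ g) = bind₁ _ (MvPolynomial.map φ g)
  rw [map_bind₁]
  exact congrArg (fun θ : τ ⊕ Fin m → MvPolynomial τ S => bind₁ θ (MvPolynomial.map φ g))
    (funext fun i => by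
      rcases i with x | j
      · simp
      · by_cases h : e j <;> simp [h])

/-- Substituting parameter-free data (`X`'s, `0`, `1`) over the parameter ring does not raise the
parameter degree of the coefficients. [folklore] -/
theorem cdeg_aeval_base {σ ι P : Type} {D : ℕ} (θ : ι → MvPolynomial σ (MvPolynomial P ℚ))
    (hθ : ∀ i d, (coeff d (θ i)).totalDegree ≤ 0) (G : MvPolynomial ι (MvPolynomial P ℚ))
    (hG : ∀ a, (coeff a G).totalDegree ≤ D) :
    ∀ d, (coeff d (aeval θ G)).totalDegree ≤ D := by
  classical
  have hsum : aeval θ G = ∑ a ∈ G.support, aeval θ (monomial a (coeff a G)) := by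
    conv_lhs => rw [G.as_sum]
    rw [map_sum]
  rw [hsum]
  refine cdeg_sum _ fun a _ => ?_
  rw [aeval_monomial, MvPolynomial.algebraMap_eq]
  have h2 : ∀ d, (coeff d (a.prod fun i e => θ i ^ e)).totalDegree ≤ ∑ i ∈ a.support, a i * 0 :=
    cdeg_prod _ fun i _ => cdeg_pow (hθ i) (a i)
  have h3 := cdeg_mul (cdeg_C (σ := σ) (coeff a G)) h2
  simp only [mul_zero, Finset.sum_const_zero, add_zero] at h3
  exact fun d => (h3 d).trans (hG a)

/-- **Boolean sums preserve coefficient degrees in the parameters.** [folklore] -/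
theorem cdeg_boolSum {σ P : Type} {m D : ℕ} (G : MvPolynomial (σ ⊕ Fin m) (MvPolynomial P ℚ))
    (hG : ∀ a, (coeff a G).totalDegree ≤ D) : ∀ d, (coeff d (boolSum G)).totalDegree ≤ D := by
  classical
  unfold boolSum
  refine cdeg_sum _ fun e _ => cdeg_aeval_base _ (fun i d => ?_) G hG
  rcases i with x | j
  · exact cdeg_X (P := P) x d
  · simp only [Sum.elim_inr]
    by_cases h : e j
    · rw [if_pos h]; exact cdeg_one d
    · rw [if_neg h]; simp

/-! ### VNP families satisfy the degree format -/

/-- **`VNP^ℂ` has the p-bounded DEGREE FORMAT** — the same conclusion as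
`isVPBarFamily_degreeBound` / `degreeBound_of_chClosureDefinable`. So degree-type invariants of the
coefficients cannot distinguish `\overline{VP}^ℂ` from `VNP^ℂ`. [cite: Valiant1979]
[cite: BurgisserClausenShokrollahi1997, Thm. (9.3) (§9.1)] -/
theorem isVNPFamily_degreeBound {v : ℕ → ℕ} {f : ∀ n, MvPolynomial (Fin (v n)) ℂ} (hf : IsVNPFamily f) :
    ∃ B : ℕ → ℕ, IsPBounded B ∧ ∀ n, ∀ {ι : Type} [Fintype ι] (c : ι → (Fin (v n) →₀ ℕ)) (δ : ι → ℕ),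
      LinearIndependent ℚ (fun j : (∀ i, Fin (δ i)) => ∏ i, coeff (c i) (f n) ^ ((j i : ℕ))) →
        ∏ i, δ i ≤ (2 ^ B n * ∑ i, (δ i - 1) + 1) ^ B n := by
  obtain ⟨_, u, g, ⟨hpg, hcomp⟩, hfg⟩ := hf
  have hvu : IsPBounded fun n => v n + u n := by
    simpa [Fintype.card_sum, Fintype.card_fin] using hpg.1
  have hrb : IsPBounded fun n => complexity (g n) := hcomp
  let a : ℕ → ℕ := fun n =>
    2 * ((v n + u n + 2 * complexity (g n) + 1) * (8 * (v n + u n + 2 * complexity (g n) + 1) + 1))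
  let B : ℕ → ℕ := fun n => a n + paramCount (v n + u n) (complexity (g n))
  have hN : IsPBounded fun n => v n + u n + 2 * complexity (g n) + 1 :=
    IsPBounded.add_holds (IsPBounded.add_holds hvu (IsPBounded.mul_holds (IsPBounded.const 2) hrb))
      (IsPBounded.const 1)
  have ha : IsPBounded a := IsPBounded.mul_holds (IsPBounded.const 2) (IsPBounded.mul_holds hN
    (IsPBounded.add_holds (IsPBounded.mul_holds (IsPBounded.const 8) hN) (IsPBounded.const 1)))
  refine ⟨B, IsPBounded.add_holds ha (isPBounded_paramCount hvu hrb), fun n ι _ c δ hind => ?_⟩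
  classical
  -- `g n = Φ_N(γ)` for some `s ≤ L(g n)`, `N = (v n + u n) + 2 s + 1`
  obtain ⟨s, hs, γ, hγ⟩ :=
    exists_phi_of_complexity_le (σ := Fin (v n) ⊕ Fin (u n)) (g := g n) (le_refl (complexity (g n)))
  have hsr : s ≤ complexity (g n) := by simpa [Finset.mem_range, Nat.lt_succ_iff] using hs
  -- coefficients of `f n` are values at `γ` of the Boolean-summed generic coefficient polynomials
  let K : ι → MvPolynomial (Par (Fintype.card (Fin (v n) ⊕ Fin (u n)) + 2 * s + 1)
      (Fin (v n) ⊕ Fin (u n))) ℚ :=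
    fun i => coeff (c i) (boolSum (phiGen (σ := Fin (v n) ⊕ Fin (u n))
      (Fintype.card (Fin (v n) ⊕ Fin (u n)) + 2 * s + 1)))
  have hcoef : ∀ i, coeff (c i) (f n) = aeval γ (K i) := by
    intro i
    have h1 : f n = MvPolynomial.map (aeval γ : MvPolynomial (Par (Fintype.card (Fin (v n) ⊕
        Fin (u n)) + 2 * s + 1) (Fin (v n) ⊕ Fin (u n))) ℚ →ₐ[ℚ] ℂ)
        (boolSum (phiGen (σ := Fin (v n) ⊕ Fin (u n))
          (Fintype.card (Fin (v n) ⊕ Fin (u n)) + 2 * s + 1))) := by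
      rw [hfg n, ← hγ, phi_eq_map_phiGen, map_boolSum_eq]
    rw [h1, coeff_map]
    rfl
  have hdeg : ∀ i, (K i).totalDegree ≤ (MalodGeneric.genericComputation ℚ
      (Fintype.card (Fin (v n) ⊕ Fin (u n)) + 2 * s + 1)).totalDegree :=
    fun i => cdeg_boolSum (phiGen (σ := Fin (v n) ⊕ Fin (u n)) _)
      (fun a => totalDegree_coeffPoly_le _ a) (c i)
  have hfun : (fun j : (∀ i, Fin (δ i)) => ∏ i, coeff (c i) (f n) ^ ((j i : ℕ))) =
      fun j => ∏ i, aeval γ (K i) ^ ((j i : ℕ)) := by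
    funext j
    exact Finset.prod_congr rfl fun i _ => by rw [hcoef i]
  rw [hfun] at hind
  have h := prod_le_of_linearIndependent_aeval K hdeg γ δ hind
  rw [card_par] at h
  -- compare with the uniform bound `B n` (keep `Fintype.card (Fin v ⊕ Fin u)` literal: it occurs in
  -- dependent positions, so rewrite it only inside pure-ℕ inequalities)
  have hcard : Fintype.card (Fin (v n) ⊕ Fin (u n)) = v n + u n := by simp
  have hpc : paramCount (Fintype.card (Fin (v n) ⊕ Fin (u n))) s ≤ B n := by
    rw [hcard]
    exact (paramCount_mono _ hsr).trans (Nat.le_add_left _ _)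
  have htd : (MalodGeneric.genericComputation ℚ
      (Fintype.card (Fin (v n) ⊕ Fin (u n)) + 2 * s + 1)).totalDegree ≤ 2 ^ B n := by
    refine (totalDegree_genericComputation_le _).trans (Nat.pow_le_pow_right two_pos ?_)
    rw [hcard]
    refine le_trans ?_ (Nat.le_add_right (a n) (paramCount (v n + u n) (complexity (g n))))
    have : v n + u n + 2 * s + 1 ≤ v n + u n + 2 * complexity (g n) + 1 := by omega
    exact Nat.mul_le_mul_left 2 (Nat.mul_le_mul this (by omega))
  have hbase : (MalodGeneric.genericComputation ℚ
      (Fintype.card (Fin (v n) ⊕ Fin (u n)) + 2 * s + 1)).totalDegree * (∑ i, (δ i - 1)) + 1 ≤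
      2 ^ B n * (∑ i, (δ i - 1)) + 1 :=
    Nat.add_le_add_right (Nat.mul_le_mul_right _ htd) 1
  exact h.trans ((Nat.pow_le_pow_left hbase _).trans (Nat.pow_le_pow_right (Nat.succ_pos _) hpc))

/-! ### The tower family is outside VNP too -/

/-- The degree-format bound is violated by the tower family: no p-bounded `B` can satisfy
`2^{2^n} ≤ (2^{B n} · 2^n + 1)^{B n}` for all `n`. [folklore] -/
theorem towerFamily_violates_degreeBound {t : ℂ} (ht : Transcendental ℚ t) {B : ℕ → ℕ} (hB : IsPBounded B)
    (h : ∀ n, ∀ {ι : Type} [Fintype ι] (c : ι → (Fin n →₀ ℕ)) (δ : ι → ℕ),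
      LinearIndependent ℚ (fun j : (∀ i, Fin (δ i)) => ∏ i, coeff (c i) (towerFamily t n) ^ ((j i : ℕ))) →
        ∏ i, δ i ≤ (2 ^ B n * ∑ i, (δ i - 1) + 1) ^ B n) : False := by
  classical
  let B' : ℕ → ℕ := fun n => (B n + n + 1) * B n
  have hB' : IsPBounded B' :=
    IsPBounded.mul_holds (IsPBounded.add_holds (IsPBounded.add_holds hB IsPBounded.id) (IsPBounded.const 1)) hB
  have key : ∀ n, 2 ^ n ≤ B' n := by
    intro n
    have h1 := h n expVec (fun _ => 2) (linearIndependent_powerProducts_towerFamily ht n)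
    simp only [Finset.prod_const, Finset.sum_const, Finset.card_univ, Fintype.card_finset,
      Fintype.card_fin, smul_eq_mul, Nat.add_one_sub_one, mul_one] at h1
    have h2 : (2 ^ B n * 2 ^ n + 1) ^ B n ≤ 2 ^ B' n := by
      have : 2 ^ B n * 2 ^ n + 1 ≤ 2 ^ (B n + n + 1) := by
        rw [← pow_add, pow_succ]; have := Nat.one_le_two_pow (n := B n + n); omega
      calc (2 ^ B n * 2 ^ n + 1) ^ B n ≤ (2 ^ (B n + n + 1)) ^ B n := Nat.pow_le_pow_left this _
        _ = 2 ^ B' n := by rw [← pow_mul]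
    exact (Nat.pow_le_pow_iff_right (by norm_num)).mp (h1.trans h2)
  obtain ⟨n, hn⟩ := hB'.exists_lt_two_pow_self
  exact absurd (key n) (not_le.mpr hn)

/-- **The tower family is not in `VNP^ℂ`** (transcendental `t`): it violates the degree format that
`VNP^ℂ` satisfies. Together with `not_isVPBarFamily_towerFamily`: an explicit p-family outside
`\overline{VP}^ℂ ∪ VNP^ℂ`, certifying that the degree instrument says nothing about `VP` versus `VNP`.
[cite: BurgisserClausenShokrollahi1997, Cor. (9.4) (§9.1)] [cite: Valiant1979] -/
theorem not_isVNPFamily_towerFamily {t : ℂ} (ht : Transcendental ℚ t) : ¬ IsVNPFamily (towerFamily t) := by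
  intro hf
  obtain ⟨B, hB, h⟩ := isVNPFamily_degreeBound hf
  exact towerFamily_violates_degreeBound ht hB h

end Summit.ValiantsHypothesis.ValiantsHypothesis.Theorems.VPBoundarySquareVNPDegreeFormat

end
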